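import Literature.Geometry.Kaehler.PoincareLemmaFlat
import Literature.NumberTheory.Transcendental.FormIntegrationCharts
import Mathlib.Analysis.Calculus.FDeriv.ContinuousAlternatingMap
import HarnessLib

/-!
# The homotopy operator of a linear homotopy `H_σ = id - (1 - σ) Q`

Companion of `Literature/Geometry/Kaehler/PoincareLemmaFlat.lean` (radial homotopy operator)
and `TranslationHomotopy.lean`.  For a continuous linear map `Q : E →L[ℝ] E` on a real normed
space consider the LINEAR homotopy `H_σ = id - (1 - σ) Q` from `H₀ = P := id - Q` to `H₁ = id`
(for `Q` a projection, `P` is the complementary projection: the straight-line homotopy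
contracting the fibres of `P`; for `Q = id` it is the radial contraction to `0`).  For Mathlib's
exterior derivative `extDeriv` of forms `ω : E → E [⋀^Fin (k+1)]→L[ℝ] F` we construct the
**homotopy operator**

  `K ω x = ∫₀¹ H_σ^* (ι_{Q x} ω (H_σ x)) dσ`
  (`linHomOperator`; the integrand is `((ω (H_σ x)).curryLeft (Q x)).compContinuousLinearMap H_σ`),

prove that it preserves smoothness (`contDiff_linHomOperator`) and the **homotopy formula**

  `d (K ω) x + K (dω) x = ω x - P^* ω x`,  `P^* ω x = (ω (P x)).compContinuousLinearMap P`

(`extDeriv_linHomOperator_add`), for smooth `ω` on a finite-dimensional `E`.  With `E = E' × ℝ`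
and `Q (u, t) = (0, t)` this is the fibre homotopy operator of `E' × ℝ ⊇ E' × {0}`
(integration along the segments `{u} × [0, t]`) with its explicit factor `t` in front
(`ι_{Q x} = t ι_{(0,1)}`): the relative Poincaré lemma used in Moser arguments near a
hypersurface (Cannas da Silva–Guillemin–Woodward 2000, proof of Thm. 1; McDuff–Salamon 2017,
Lemma 3.2.1 / proof of Thm. 3.4.10).

## References

* R. Bott, L. W. Tu, *Differential Forms in Algebraic Topology* (1982), §I.4 (homotopy operator
  of a homotopy, `dK + Kd = h₁^* - h₀^*`). [BottTu1982Forms]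
* D. McDuff, D. Salamon, *Introduction to Symplectic Topology*, 3rd ed. (2017), §3.2 (relative
  Poincaré lemma / Moser isotopy). [McDuffSalamon2017]
-/

noncomputable section

open scoped Topology ContDiff
open Set Filter MeasureTheory intervalIntegral ContinuousAlternatingMap

namespace Literature.Geometry.Kaehler

variable {E : Type*} [NormedAddCommGroup E] [NormedSpace ℝ E]
  {F : Type*} [NormedAddCommGroup F] [NormedSpace ℝ F] {k : ℕ}

section LinHom

variable (Q : E →L[ℝ] E)

/-- The linear homotopy `H_σ = id - (1 - σ) Q` (`H₁ = id`, `H₀ = id - Q`). Bott–Tu (1982), §I.4.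
[cite: BottTu1982Forms, §I.4] -/
def linHom (σ : ℝ) : E →L[ℝ] E := ContinuousLinearMap.id ℝ E - (1 - σ) • Q

/-- `H_σ x = x - (1 - σ) Q x`. [folklore] -/
theorem linHom_apply (σ : ℝ) (x : E) : linHom Q σ x = x - (1 - σ) • Q x := rfl

/-- `H₁ = id`. [folklore] -/
theorem linHom_one : linHom Q 1 = ContinuousLinearMap.id ℝ E := by
  simp [linHom]

/-- `H₀ = id - Q`. [folklore] -/
theorem linHom_zero : linHom Q 0 = ContinuousLinearMap.id ℝ E - Q := by
  simp [linHom]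

/-- `σ ↦ H_σ x` has derivative `Q x`. [folklore] -/
theorem hasDerivAt_linHom_apply (x : E) (σ : ℝ) :
    HasDerivAt (fun σ : ℝ ↦ linHom Q σ x) (Q x) σ := by
  have h1 : HasDerivAt (fun σ : ℝ ↦ (1 - σ)) (-1) σ := by
    simpa using (hasDerivAt_id σ).const_sub (1 : ℝ)
  have h3 := (h1.smul_const (Q x)).const_sub x
  show HasDerivAt (fun σ : ℝ ↦ x - (1 - σ) • Q x) (Q x) σ
  simpa using h3

/-- `σ ↦ H_σ` is `C^∞` (affine) as a map into operators. [folklore] -/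
theorem contDiff_linHom : ContDiff ℝ ∞ (fun σ : ℝ ↦ linHom Q σ) :=
  contDiff_const.sub ((contDiff_const.sub contDiff_id).smul contDiff_const)

/-- `(σ, x) ↦ H_σ x` is `C^∞`. [folklore] -/
theorem contDiff_linHom_uncurry : ContDiff ℝ ∞ (fun p : ℝ × E ↦ linHom Q p.1 p.2) := by
  have h : ContDiff ℝ ∞ (fun p : ℝ × E ↦ p.2 - (1 - p.1) • Q p.2) :=
    contDiff_snd.sub ((contDiff_const.sub contDiff_fst).smul (Q.contDiff.comp contDiff_snd))
  exact h

/-- The integrand of the homotopy operator of `H`: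
`(σ, x) ↦ H_σ^* (ι_{Q x} ω (H_σ x))`, a `k`-form for a `(k+1)`-form `ω`. Bott–Tu (1982), §I.4.
[cite: BottTu1982Forms, §I.4] -/
def linHomIntegrand (β : E → E [⋀^Fin (k + 1)]→L[ℝ] F) (p : ℝ × E) : E [⋀^Fin k]→L[ℝ] F :=
  ((β (linHom Q p.1 p.2)).curryLeft (Q p.2)).compContinuousLinearMap (linHom Q p.1)

/-- **The homotopy operator of the linear homotopy `H_σ = id - (1 - σ) Q`**:
`K ω x = ∫₀¹ H_σ^* (ι_{Q x} ω (H_σ x)) dσ`. Bott–Tu (1982), §I.4. [cite: BottTu1982Forms, §I.4] -/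
def linHomOperator (β : E → E [⋀^Fin (k + 1)]→L[ℝ] F) (x : E) : E [⋀^Fin k]→L[ℝ] F :=
  ∫ σ in (0 : ℝ)..1, linHomIntegrand Q β (σ, x)

/-- Value of the integrand on a tuple. [folklore] -/
theorem linHomIntegrand_apply (β : E → E [⋀^Fin (k + 1)]→L[ℝ] F) (σ : ℝ) (x : E)
    (v : Fin k → E) :
    linHomIntegrand Q β (σ, x) v =
      β (linHom Q σ x) (Matrix.vecCons (Q x) (fun i ↦ linHom Q σ (v i))) := by
  simp [linHomIntegrand, curryLeft_apply_apply, Function.comp_def]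

/-- `K` of the zero form: the integrand vanishes. [folklore] -/
@[simp]
theorem linHomIntegrand_zero :
    linHomIntegrand Q (0 : E → E [⋀^Fin (k + 1)]→L[ℝ] F) = 0 := by
  funext p
  obtain ⟨σ, x⟩ := p
  ext v
  simp [linHomIntegrand_apply]

/-- `K 0 = 0`. [folklore] -/
@[simp]
theorem linHomOperator_zero : linHomOperator Q (0 : E → E [⋀^Fin (k + 1)]→L[ℝ] F) = 0 := by
  funext x
  simp [linHomOperator]

/-- The integrand is jointly `C^∞` for `C^∞` forms. [folklore] -/
theorem contDiff_linHomIntegrand {β : E → E [⋀^Fin (k + 1)]→L[ℝ] F} (hβ : ContDiff ℝ ∞ β) :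
    ContDiff ℝ ∞ (linHomIntegrand Q β) := by
  have hJ : ContDiff ℝ ∞ (fun p : ℝ × E ↦ (β (linHom Q p.1 p.2)).curryLeft (Q p.2)) :=
    (isBoundedBilinearMap_curryLeft (E := E) (F := F) (k := k)).contDiff.comp
      ((hβ.comp (contDiff_linHom_uncurry Q)).prodMk (Q.contDiff.comp contDiff_snd))
  have hL : ContDiff ℝ ∞ (fun p : ℝ × E ↦ linHom Q p.1) := (contDiff_linHom Q).comp contDiff_fst
  rw [contDiff_iff_contDiffAt]
  intro p
  exact
    Literature.NumberTheory.Transcendental.ContDiffAt.continuousAlternatingMapCompContinuousLinearMap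
      hJ.contDiffAt hL.contDiffAt

/-- The integrand at fixed `x` is continuous in `σ`. [folklore] -/
theorem continuous_linHomIntegrand_left {β : E → E [⋀^Fin (k + 1)]→L[ℝ] F} (hβ : ContDiff ℝ ∞ β)
    (x : E) : Continuous fun σ : ℝ ↦ linHomIntegrand Q β (σ, x) :=
  (contDiff_linHomIntegrand Q hβ).continuous.comp (continuous_id.prodMk continuous_const)

/-- **The partial derivative in `x` of the integrand** at `(σ, x)` applied to `h`:
`H_σ^* (ι_{Q x} (Dω (H_σ x) (H_σ h))) + H_σ^* (ι_{Q h} ω (H_σ x))`. [folklore] -/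
theorem fderiv_linHomIntegrand_apply {β : E → E [⋀^Fin (k + 1)]→L[ℝ] F} (hβ : ContDiff ℝ ∞ β)
    (σ : ℝ) (x h : E) :
    fderiv ℝ (fun y ↦ linHomIntegrand Q β (σ, y)) x h =
      ((fderiv ℝ β (linHom Q σ x) (linHom Q σ h)).curryLeft (Q x)).compContinuousLinearMap
          (linHom Q σ) +
        ((β (linHom Q σ x)).curryLeft (Q h)).compContinuousLinearMap (linHom Q σ) := by
  set L := linHom Q σ with hL
  have hβL : HasFDerivAt (fun y : E ↦ β (L y)) ((fderiv ℝ β (L x)).comp L) x :=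
    ((hβ.differentiable (by simp)) (L x)).hasFDerivAt.comp x L.hasFDerivAt
  have hb := (isBoundedBilinearMap_curryLeft (E := E) (F := F) (k := k)).hasFDerivAt (β (L x), Q x)
  have hJ := hb.comp x (hβL.prodMk Q.hasFDerivAt)
  have hK := (ContinuousAlternatingMap.compContinuousLinearMapCLM (ι := Fin k) (F := F)
    L).hasFDerivAt.comp x hJ
  have hK' : HasFDerivAt (fun y ↦ linHomIntegrand Q β (σ, y)) _ x := hK
  rw [hK'.fderiv]
  simp only [ContinuousLinearMap.comp_apply, IsBoundedBilinearMap.deriv_apply,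
    ContinuousAlternatingMap.compContinuousLinearMapCLM_apply, ContinuousLinearMap.prod_apply]
  exact (map_add (ContinuousAlternatingMap.compContinuousLinearMapCLM (ι := Fin k) (F := F) L)
    _ _).trans (add_comm _ _)

variable [FiniteDimensional ℝ E]

/-- **The homotopy operator preserves smoothness.** [folklore] -/
theorem contDiff_linHomOperator {β : E → E [⋀^Fin (k + 1)]→L[ℝ] F} (hβ : ContDiff ℝ ∞ β) :
    ContDiff ℝ ∞ (linHomOperator Q β) :=
  Literature.Analysis.FunctionSpaces.contDiff_parametric_intervalIntegral
    (contDiff_linHomIntegrand Q hβ) 0 1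


/-! ### The homotopy formula -/

omit [FiniteDimensional ℝ E] in
/-- Moving an updated entry of an alternating map to the front:
`c (update m i z) = (-1)^i • c (z, m without its i-th entry)`. [folklore] -/
theorem apply_update_eq_pow_smul (c : E [⋀^Fin (k + 1)]→L[ℝ] F) (m : Fin (k + 1) → E)
    (i : Fin (k + 1)) (z : E) :
    c (Function.update m i z) = (-1 : ℝ) ^ (i : ℕ) • c (Matrix.vecCons z (i.removeNth m)) := by
  rw [← Fin.insertNth_removeNth i z m]
  have h := c.toAlternatingMap.map_insertNth i z (i.removeNth m)
  rw [← Int.cast_smul_eq_zsmul ℝ, Int.cast_pow, Int.cast_neg, Int.cast_one] at h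
  exact h

/-- **The homotopy formula** `d (K ω) x + K (dω) x = ω x - P^*ω x` for the homotopy operator of
the linear homotopy `H_σ = id - (1 - σ) Q` (`P = id - Q`) and a `C^∞` form `ω` of positive
degree on a finite-dimensional space (`F` complete).  Proof: differentiate under the integral
sign; pointwise in `σ` the integrand of `d (K ω) x + K (dω) x` is the `σ`-derivative of
`H_σ^* ω x = (ω (H_σ x)).compContinuousLinearMap H_σ` (the terms of the two alternating sums
cancel in pairs except the one extracting `Q x`, and the remaining sum is the derivative of the
pull-back along `σ ↦ H_σ`, `d/dσ H_σ = Q`); integrate `d/dσ` by the fundamental theorem of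
calculus.  Bott–Tu (1982), §I.4 (`dK + Kd = h₁^* - h₀^*`). [cite: BottTu1982Forms, §I.4] -/
theorem extDeriv_linHomOperator_add [CompleteSpace F] {β : E → E [⋀^Fin (k + 1)]→L[ℝ] F}
    (hβ : ContDiff ℝ ∞ β) (x : E) :
    extDeriv (linHomOperator Q β) x + linHomOperator Q (extDeriv β) x =
      β x - (β ((ContinuousLinearMap.id ℝ E - Q) x)).compContinuousLinearMap
        (ContinuousLinearMap.id ℝ E - Q) := by
  have hinf : (∞ : WithTop ℕ∞) ≠ 0 := by simp
  have hH : ContDiff ℝ ∞ (linHomIntegrand Q β) := contDiff_linHomIntegrand Q hβ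
  -- the partial derivative in `x` of the integrand, at `(σ, x)`
  set D : ℝ → E →L[ℝ] E [⋀^Fin k]→L[ℝ] F :=
    fun σ ↦ fderiv ℝ (fun y ↦ linHomIntegrand Q β (σ, y)) x with hD
  have hDapply : ∀ σ h, D σ h =
      ((fderiv ℝ β (linHom Q σ x) (linHom Q σ h)).curryLeft (Q x)).compContinuousLinearMap
          (linHom Q σ) +
        ((β (linHom Q σ x)).curryLeft (Q h)).compContinuousLinearMap (linHom Q σ) := fun σ h ↦
    fderiv_linHomIntegrand_apply Q hβ σ x h
  have hDH : ∀ σ h, fderiv ℝ (linHomIntegrand Q β) (σ, x) ((0 : ℝ), h) = D σ h := by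
    intro σ h
    have h1 := (Literature.Analysis.FunctionSpaces.hasFDerivAt_comp_prodMk hH hinf σ x).fderiv
    rw [hD]
    dsimp only
    rw [h1]
    rfl
  -- the derivative of `K β` in the direction `h`, under the integral sign
  have hKd : ∀ h, fderiv ℝ (linHomOperator Q β) x h = ∫ σ in (0 : ℝ)..1, D σ h := by
    intro h
    have h1 := Literature.Analysis.FunctionSpaces.fderiv_parametric_intervalIntegral_apply hH hinf
      0 1 x h
    simp only [hDH] at h1
    exact h1
  have hDc : ∀ h, Continuous fun σ ↦ D σ h := by
    intro h
    have h1 : Continuous fun σ : ℝ ↦ fderiv ℝ (linHomIntegrand Q β) (σ, x) ((0 : ℝ), h) :=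
      ((hH.continuous_fderiv hinf).comp (continuous_id.prodMk continuous_const)).clm_apply
        continuous_const
    simp only [hDH] at h1
    exact h1
  -- `dβ` and its integrand
  set dβ : E → E [⋀^Fin (k + 1 + 1)]→L[ℝ] F := extDeriv β with hdβ
  have hdβs : ContDiff ℝ ∞ dβ := by
    rw [hdβ]
    exact (alternatizeUncurryFinCLM ℝ E F).contDiff.comp (hβ.fderiv_right (m := ∞) (by simp))
  -- evaluate on a tuple `v`
  ext v
  -- the pull-back `σ ↦ H_σ^* β x` evaluated on `v`, and its derivative
  set Φ : ℝ → F := fun σ ↦ β (linHom Q σ x) (fun i ↦ linHom Q σ (v i)) with hΦ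
  set Φ' : ℝ → F := fun σ ↦ fderiv ℝ β (linHom Q σ x) (Q x) (fun i ↦ linHom Q σ (v i)) +
    ∑ i : Fin (k + 1),
      β (linHom Q σ x) (Function.update (fun j ↦ linHom Q σ (v j)) i (Q (v i))) with hΦ'
  have hΦderiv : ∀ σ, HasDerivAt Φ (Φ' σ) σ := by
    intro σ
    -- `σ ↦ β (H_σ x)` and `σ ↦ H_σ (v i)`
    have hf : HasFDerivAt (fun σ : ℝ ↦ β (linHom Q σ x))
        ((fderiv ℝ β (linHom Q σ x)).comp ((1 : ℝ →L[ℝ] ℝ).smulRight (Q x))) σ := by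
      have h1 : HasFDerivAt (fun σ : ℝ ↦ linHom Q σ x) ((1 : ℝ →L[ℝ] ℝ).smulRight (Q x)) σ :=
        (hasDerivAt_linHom_apply Q x σ).hasFDerivAt
      exact ((hβ.differentiable hinf) _).hasFDerivAt.comp σ h1
    have hg : ∀ i : Fin (k + 1), HasFDerivAt (fun σ : ℝ ↦ linHom Q σ (v i))
        ((1 : ℝ →L[ℝ] ℝ).smulRight (Q (v i))) σ := fun i ↦
      (hasDerivAt_linHom_apply Q (v i) σ).hasFDerivAt
    have h := hf.continuousAlternatingMap_apply hg
    have h' : HasDerivAt Φ _ σ := h.hasDerivAt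
    convert h' using 1
    simp [hΦ']
  have hΦ'c : Continuous Φ' := by
    have hLc : Continuous fun σ : ℝ ↦ linHom Q σ := (contDiff_linHom Q).continuous
    have hyc : Continuous fun σ : ℝ ↦ linHom Q σ x := hLc.clm_apply continuous_const
    have hvc : ∀ i, Continuous fun σ : ℝ ↦ linHom Q σ (v i) := fun i ↦
      hLc.clm_apply continuous_const
    have htuple : Continuous fun σ : ℝ ↦ (fun i ↦ linHom Q σ (v i)) := continuous_pi hvc
    refine Continuous.add ?_ (continuous_finsetSum _ fun i _ ↦ ?_)
    · have h1 : Continuous fun σ : ℝ ↦ fderiv ℝ β (linHom Q σ x) (Q x) :=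
        ((hβ.continuous_fderiv hinf).comp hyc).clm_apply continuous_const
      exact h1.eval htuple
    · refine (hβ.continuous.comp hyc).eval ?_
      exact continuous_pi fun j ↦ by
        by_cases hji : j = i
        · subst hji
          simpa using (continuous_const : Continuous fun _ : ℝ ↦ Q (v j))
        · simpa [Function.update_of_ne hji] using hvc j
  -- pointwise identity of the integrands (evaluated on `v`)
  have hpt : ∀ σ, alternatizeUncurryFin (D σ) v + linHomIntegrand Q dβ (σ, x) v = Φ' σ := by
    intro σ
    -- the `K dβ` integrand, expanded: first the term extracting `(Q x)`, then the others
    have hK : linHomIntegrand Q dβ (σ, x) v =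
        fderiv ℝ β (linHom Q σ x) (Q x) (fun i ↦ linHom Q σ (v i)) -
          ∑ i : Fin (k + 1), (-1 : ℝ) ^ (i : ℕ) •
            fderiv ℝ β (linHom Q σ x) (linHom Q σ (v i))
              (Matrix.vecCons (Q x) (i.removeNth fun j ↦ linHom Q σ (v j))) := by
      rw [linHomIntegrand_apply]
      simp only [hdβ, extDeriv, alternatizeUncurryFin_apply, ← Int.cast_smul_eq_zsmul ℝ,
        Int.cast_pow, Int.cast_neg, Int.cast_one]
      rw [Fin.sum_univ_succ]
      have htail : ∀ w : Fin (k + 1) → E, Fin.tail (Matrix.vecCons (Q x) w) = w := fun w ↦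
        funext fun i ↦ by simp [Fin.tail]
      simp only [Fin.val_zero, pow_zero, one_smul, Matrix.cons_val_zero, Fin.removeNth_zero, htail,
        Fin.val_succ, Matrix.cons_val_succ, removeNth_succ_vecCons, pow_succ, mul_neg_one,
        neg_smul, Finset.sum_neg_distrib]
      abel
    -- the `d K β` integrand, expanded
    have hA : alternatizeUncurryFin (D σ) v =
        ∑ i : Fin (k + 1), (-1 : ℝ) ^ (i : ℕ) •
            fderiv ℝ β (linHom Q σ x) (linHom Q σ (v i))
              (Matrix.vecCons (Q x) (i.removeNth fun j ↦ linHom Q σ (v j))) +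
          ∑ i : Fin (k + 1), (-1 : ℝ) ^ (i : ℕ) •
            β (linHom Q σ x) (Matrix.vecCons (Q (v i)) (i.removeNth fun j ↦ linHom Q σ (v j))) := by
      simp only [alternatizeUncurryFin_apply, ← Int.cast_smul_eq_zsmul ℝ, Int.cast_pow,
        Int.cast_neg, Int.cast_one, hDapply, ContinuousAlternatingMap.add_apply, smul_add,
        Finset.sum_add_distrib, ContinuousAlternatingMap.compContinuousLinearMap_apply,
        curryLeft_apply_apply]
      rfl
    -- the remaining sum is the sum of `β` with `Q` in one slot
    have hB : ∑ i : Fin (k + 1), (-1 : ℝ) ^ (i : ℕ) •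
        β (linHom Q σ x) (Matrix.vecCons (Q (v i)) (i.removeNth fun j ↦ linHom Q σ (v j))) =
        ∑ i : Fin (k + 1),
          β (linHom Q σ x) (Function.update (fun j ↦ linHom Q σ (v j)) i (Q (v i))) := by
      refine Finset.sum_congr rfl fun i _ ↦ ?_
      rw [apply_update_eq_pow_smul]
    rw [hA, hK, hB, hΦ']
    abel
  -- assemble
  have hi2 : IntervalIntegrable (fun σ : ℝ ↦ linHomIntegrand Q dβ (σ, x)) volume 0 1 :=
    (continuous_linHomIntegrand_left Q hdβs x).intervalIntegrable 0 1
  have hi3 : IntervalIntegrable Φ' volume 0 1 := hΦ'c.intervalIntegrable 0 1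
  have hci : ∀ i : Fin (k + 1), Continuous fun σ : ℝ ↦ D σ (v i) (i.removeNth v) := fun i ↦
    (ContinuousAlternatingMap.apply ℝ E F (i.removeNth v)).continuous.comp (hDc (v i))
  have hL1 : extDeriv (linHomOperator Q β) x v =
      ∫ σ in (0 : ℝ)..1, ∑ i : Fin (k + 1), ((-1 : ℝ) ^ (i : ℕ)) • D σ (v i) (i.removeNth v) := by
    rw [intervalIntegral.integral_finsetSum]
    · simp only [extDeriv, alternatizeUncurryFin_apply, ← Int.cast_smul_eq_zsmul ℝ, Int.cast_pow,
        Int.cast_neg, Int.cast_one, hKd]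
      refine Finset.sum_congr rfl fun i _ ↦ ?_
      rw [intervalIntegral_apply_alternating ((hDc (v i)).intervalIntegrable 0 1),
        intervalIntegral.integral_smul]
    · intro i _
      exact ((hci i).const_smul _).intervalIntegrable 0 1
  have hL1' : ∀ σ, ∑ i : Fin (k + 1), ((-1 : ℝ) ^ (i : ℕ)) • D σ (v i) (i.removeNth v) =
      alternatizeUncurryFin (D σ) v := fun σ ↦ by
    simp only [alternatizeUncurryFin_apply, ← Int.cast_smul_eq_zsmul ℝ, Int.cast_pow,
      Int.cast_neg, Int.cast_one]
  have hi1 : IntervalIntegrable (fun σ : ℝ ↦ alternatizeUncurryFin (D σ) v) volume 0 1 := by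
    have hc : Continuous fun σ : ℝ ↦
        ∑ i : Fin (k + 1), ((-1 : ℝ) ^ (i : ℕ)) • D σ (v i) (i.removeNth v) :=
      continuous_finsetSum _ fun i _ ↦ (hci i).const_smul _
    simp only [hL1'] at hc
    exact hc.intervalIntegrable 0 1
  have hi2v : IntervalIntegrable (fun σ : ℝ ↦ linHomIntegrand Q dβ (σ, x) v) volume 0 1 :=
    ((ContinuousAlternatingMap.apply ℝ E F v).continuous.comp
      (continuous_linHomIntegrand_left Q hdβs x)).intervalIntegrable 0 1
  rw [ContinuousAlternatingMap.add_apply, hL1, linHomOperator,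
    intervalIntegral_apply_alternating hi2]
  simp only [hL1']
  rw [← intervalIntegral.integral_add hi1 hi2v]
  simp only [hpt]
  rw [intervalIntegral.integral_eq_sub_of_hasDerivAt (fun σ _ ↦ hΦderiv σ) hi3]
  simp [hΦ, linHom_one, linHom_zero, ContinuousAlternatingMap.sub_apply,
    ContinuousAlternatingMap.compContinuousLinearMap_apply, Function.comp_def]

end LinHom


/-! ### The fibre homotopy operator of `E' × ℝ ⊇ E' × {0}` -/

section Fibre

variable {E' : Type*} [NormedAddCommGroup E'] [NormedSpace ℝ E']

/-- The vertical part `Q (u, t) = (0, t) = t • (0, 1)` of `E' × ℝ`. [folklore] -/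
theorem inr_comp_snd_apply_eq_smul (x : E' × ℝ) :
    ((ContinuousLinearMap.inr ℝ E' ℝ).comp (ContinuousLinearMap.snd ℝ E' ℝ)) x =
      x.2 • (((0 : E'), (1 : ℝ)) : E' × ℝ) := by
  ext <;> simp

/-- The linear homotopy of the vertical part is `H_σ (u, t) = (u, σ t)`. [folklore] -/
theorem linHom_inr_comp_snd_apply (σ : ℝ) (x : E' × ℝ) :
    linHom ((ContinuousLinearMap.inr ℝ E' ℝ).comp (ContinuousLinearMap.snd ℝ E' ℝ)) σ x =
      (x.1, σ * x.2) := by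
  rw [linHom_apply]
  ext <;> simp
  ring

/-- Its end point `P = id - Q` is the projection `(u, t) ↦ (u, 0)`. [folklore] -/
theorem id_sub_inr_comp_snd_apply (x : E' × ℝ) :
    (ContinuousLinearMap.id ℝ (E' × ℝ) -
      (ContinuousLinearMap.inr ℝ E' ℝ).comp (ContinuousLinearMap.snd ℝ E' ℝ)) x = (x.1, 0) := by
  ext <;> simp

/-- **The explicit factor `t`**: the integrand of the fibre homotopy operator at `(σ, (u, t))` is
`t • H_σ^* (ι_{(0,1)} ω (u, σ t))`. [folklore] -/
theorem linHomIntegrand_inr_comp_snd (β : E' × ℝ → (E' × ℝ) [⋀^Fin (k + 1)]→L[ℝ] F) (σ : ℝ)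
    (x : E' × ℝ) :
    linHomIntegrand ((ContinuousLinearMap.inr ℝ E' ℝ).comp (ContinuousLinearMap.snd ℝ E' ℝ)) β
        (σ, x) =
      x.2 • ((β (x.1, σ * x.2)).curryLeft (((0 : E'), (1 : ℝ)) : E' × ℝ)).compContinuousLinearMap
        (linHom ((ContinuousLinearMap.inr ℝ E' ℝ).comp (ContinuousLinearMap.snd ℝ E' ℝ)) σ) := by
  simp only [linHomIntegrand, linHom_inr_comp_snd_apply, inr_comp_snd_apply_eq_smul, map_smul]
  exact map_smul (ContinuousAlternatingMap.compContinuousLinearMapCLM (ι := Fin k) (F := F)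
    (linHom ((ContinuousLinearMap.inr ℝ E' ℝ).comp (ContinuousLinearMap.snd ℝ E' ℝ)) σ)) x.2 _

/-- **The fibre homotopy operator carries the explicit factor `t`**:
`K ω (u, t) = t • ∫₀¹ H_σ^* (ι_{(0,1)} ω (u, σ t)) dσ`; in particular it vanishes on `E' × {0}`.
[folklore] -/
theorem linHomOperator_inr_comp_snd (β : E' × ℝ → (E' × ℝ) [⋀^Fin (k + 1)]→L[ℝ] F)
    (x : E' × ℝ) :
    linHomOperator ((ContinuousLinearMap.inr ℝ E' ℝ).comp (ContinuousLinearMap.snd ℝ E' ℝ)) β x =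
      x.2 • ∫ σ in (0 : ℝ)..1, ((β (x.1, σ * x.2)).curryLeft
        (((0 : E'), (1 : ℝ)) : E' × ℝ)).compContinuousLinearMap
          (linHom ((ContinuousLinearMap.inr ℝ E' ℝ).comp (ContinuousLinearMap.snd ℝ E' ℝ)) σ) := by
  simp only [linHomOperator, linHomIntegrand_inr_comp_snd]
  exact intervalIntegral.integral_smul _ _

variable [FiniteDimensional ℝ E'] [CompleteSpace F]

/-- **Relative Poincaré lemma on `E' × ℝ`** (the form used in Moser arguments near a
hypersurface; McDuff–Salamon 2017, proof of Lemma 3.2.1 / Thm. 3.4.10; Cannas da Silva–Guillemin–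
Woodward 2000, proof of Thm. 1): for a CLOSED `C^∞` form `ω` of positive degree on `E' × ℝ`
whose restriction to the horizontal directions along `E' × {0}` vanishes, `μ := K ω` satisfies
`dμ = ω`, and `μ (u, t) = t • (…)` vanishes on `E' × {0}` with the factor `t` explicit.
[cite: McDuffSalamon2017, Lemma 3.2.1] -/
theorem extDeriv_linHomOperator_eq_of_closed {β : E' × ℝ → (E' × ℝ) [⋀^Fin (k + 1)]→L[ℝ] F}
    (hβ : ContDiff ℝ ∞ β) (hcl : extDeriv β = 0)
    (h0 : ∀ (u : E') (v : Fin (k + 1) → E' × ℝ), β (u, 0) (fun i ↦ ((v i).1, 0)) = 0)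
    (x : E' × ℝ) :
    extDeriv (linHomOperator ((ContinuousLinearMap.inr ℝ E' ℝ).comp
      (ContinuousLinearMap.snd ℝ E' ℝ)) β) x = β x := by
  have h := extDeriv_linHomOperator_add
    ((ContinuousLinearMap.inr ℝ E' ℝ).comp (ContinuousLinearMap.snd ℝ E' ℝ)) hβ x
  have hP : (β ((ContinuousLinearMap.id ℝ (E' × ℝ) -
      (ContinuousLinearMap.inr ℝ E' ℝ).comp
        (ContinuousLinearMap.snd ℝ E' ℝ)) x)).compContinuousLinearMap
      (ContinuousLinearMap.id ℝ (E' × ℝ) -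
        (ContinuousLinearMap.inr ℝ E' ℝ).comp (ContinuousLinearMap.snd ℝ E' ℝ)) = 0 := by
    ext v
    simp only [ContinuousAlternatingMap.compContinuousLinearMap_apply, id_sub_inr_comp_snd_apply,
      Function.comp_def]
    exact h0 x.1 v
  rw [hcl, hP, sub_zero] at h
  rw [linHomOperator_zero, Pi.zero_apply, add_zero] at h
  exact h

end Fibre

end Literature.Geometry.Kaehler

end
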